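import Literature.AlgebraicGeometry.Resolution.GeneralizedStability
import Literature.AlgebraicGeometry.Resolution.FundamentalInequalityRelative
import Mathlib.Order.Preorder.Finite
import HarnessLib

/-!
# The fundamental inequality `n ≥ ∑ᵢ eᵢ fᵢ` (Kuhlmann 2010, §1, (1)) — proof

Topic: `Literature/AlgebraicGeometry/Resolution` (valued function fields). DISCHARGE of the named
fact `FundamentalInequality` of `GeneralizedStability.lean` = F.-V. Kuhlmann, *Elimination of
ramification I: The generalized stability theorem*, Trans. AMS 362 (2010) 5697–5727 =
arXiv:1003.5678, §1, (1), p. 3: "Every finite extension `L` of a valued field `(K, v)` satisfies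
the fundamental inequality (cf. [En], [Z–S]): `n ≥ ∑_{i=1}^{g} eᵢ fᵢ` where `n = [L : K]` is the
degree of the extension, `v₁, …, v_g` are the distinct extensions of `v` from `K` to `L`,
`eᵢ = (vᵢL : vK)` are the respective ramification indices and `fᵢ = [Lvᵢ : Kv]` are the respective
inertia degrees." The source gives no proof; we follow [Z–S] = O. Zariski, P. Samuel,
*Commutative Algebra* II, Ch. VI §11, Thm. 19 with its Note for valuations of infinite rank
(pp. 55–58, 67–70 of the 1960 edition), and N. Bourbaki, *Algèbre commutative* VI §8 no. 3,
Thm. 1, organised as follows (everything PROVED):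

* `sum_ramificationIndex_mul_inertiaDegree_le_finrank` — for `L/K` finite, a valuation ring `O`
  of `K` and ANY finite set `F` of valuation rings of `L` lying over `O`,
  `∑_{P ∈ F} e(P/K) f(P/K) ≤ [L : K]`. Proof by induction over the finite tree of joins
  `J = {P ⊔ Q | P, Q ∈ F}` (valuation rings containing a common one are comparable, so the
  elements of `J` above a fixed `P` form a chain): for `V ∈ J` one shows
  `∑_{P ∈ F, P ≤ V} e(P) f(P) ≤ e(V) f(V)` by induction on the number of `P ∈ F` below `V` — the
  maximal elements `c` of `{U ∈ J | U < V}` ("children") are pairwise incomparable, pairwise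
  generate `V`, and partition the `P ≤ V`, so the relative inequality
  `∑_c e(c) f(c) ≤ e(V) f(V)` (`sum_ramificationIndex_mul_inertiaDegree_le_of_sup_eq`,
  `FundamentalInequalityRelative.lean`: Zariski–Samuel's linear-independence argument run under
  the common coarsening `V`, with relative approximation and `e(c/K) = m_c e(V/K)`) closes the
  induction; at the top `T = ⨆ F ∈ J` one ends with the one-extension bound `e(T) f(T) ≤ [L : K]`
  (`ramificationIndex_mul_inertiaDegree_le_finrank`).
* `FundamentalInequality_holds` — hence the extensions of `O` to `L` are finitely many (any
  `n + 1` of them would give `n + 1 ≤ ∑ e f ≤ n`) and satisfy `∑ e f ≤ n`.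

## Sources

* F.-V. Kuhlmann, Trans. AMS 362 (2010) = arXiv:1003.5678, §1, (1) (p. 3).
* O. Zariski, P. Samuel, *Commutative Algebra* II (1960), Ch. VI §11, Thm. 19 and Note.
* N. Bourbaki, *Algèbre commutative* Ch. VI §8 no. 3, Thm. 1.
-/

noncomputable section

open IsLocalRing

namespace Literature.AlgebraicGeometry.Resolution

universe u

section Tree

variable (K : Type u) {L : Type u} [Field K] [Field L] [Algebra K L]

omit K in
/-- Valuation rings of `L` containing a common valuation ring are comparable. [folklore] -/
theorem le_or_le_of_le_of_le {R S₁ S₂ : ValuationSubring L} (h₁ : R ≤ S₁) (h₂ : R ≤ S₂) :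
    S₁ ≤ S₂ ∨ S₂ ≤ S₁ :=
  (ValuationSubring.le_total_ideal R).total ⟨S₁, h₁⟩ ⟨S₂, h₂⟩

/-- Restriction to `K` is monotone. [folklore] -/
theorem comap_algebraMap_mono {S₁ S₂ : ValuationSubring L} (h : S₁ ≤ S₂) :
    S₁.comap (algebraMap K L) ≤ S₂.comap (algebraMap K L) := fun _ hx => h hx

/-- **The fundamental inequality for any finite set of extensions** (Zariski–Samuel II, Ch. VI
§11, Thm. 19 with its Note; Bourbaki, *Alg. Comm.* VI §8 no. 3, Thm. 1): for `L/K` finite, a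
valuation ring `O` of `K` and a finite set `F` of valuation rings of `L` with `P ∩ K = O` for all
`P ∈ F`, `∑_{P ∈ F} e(P/K) f(P/K) ≤ [L : K]`. PROVED by induction over the finite tree of joins
`{P ⊔ Q | P, Q ∈ F}` from the relative inequality
`sum_ramificationIndex_mul_inertiaDegree_le_of_sup_eq` and the one-extension bound (see the
module docstring). [cite: ZariskiSamuel1960, Ch. VI §11, Thm. 19] -/
theorem sum_ramificationIndex_mul_inertiaDegree_le_finrank [FiniteDimensional K L]
    (O : ValuationSubring K) (F : Finset (ValuationSubring L))
    (hF : ∀ P ∈ F, P.comap (algebraMap K L) = O) :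
    ∑ P ∈ F, ramificationIndex K P * inertiaDegree K P ≤ Module.finrank K L := by
  classical
  rcases F.eq_empty_or_nonempty with rfl | hFne
  · simp
  -- distinct extensions are incomparable
  have hinc : ∀ P ∈ F, ∀ Q ∈ F, P ≤ Q → P = Q := fun P hP Q hQ hPQ =>
    eq_of_le_of_comap_eq K P Q hPQ (by rw [hF P hP, hF Q hQ])
  -- the finite tree of joins
  let J : Finset (ValuationSubring L) := (F ×ˢ F).image fun PQ => PQ.1 ⊔ PQ.2
  have hJ : ∀ {V}, V ∈ J ↔ ∃ P ∈ F, ∃ Q ∈ F, P ⊔ Q = V := fun {V} => by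
    simp only [J, Finset.mem_image, Finset.mem_product, Prod.exists]
    constructor
    · rintro ⟨P, Q, ⟨hP, hQ⟩, h⟩
      exact ⟨P, hP, Q, hQ, h⟩
    · rintro ⟨P, hP, Q, hQ, h⟩
      exact ⟨P, Q, ⟨hP, hQ⟩, h⟩
  have hFJ : ∀ P ∈ F, P ∈ J := fun P hP => hJ.mpr ⟨P, hP, P, hP, sup_idem _⟩
  have hJO : ∀ V ∈ J, O ≤ V.comap (algebraMap K L) := fun V hV => by
    obtain ⟨P, hP, Q, -, rfl⟩ := hJ.mp hV
    rw [← hF P hP]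
    exact comap_algebraMap_mono K le_sup_left
  -- the members of `F` below a valuation ring
  obtain ⟨below, hbelow⟩ : ∃ below : ValuationSubring L → Finset (ValuationSubring L),
      ∀ V P, P ∈ below V ↔ P ∈ F ∧ P ≤ V :=
    ⟨fun V => F.filter (· ≤ V), fun V P => Finset.mem_filter⟩
  have hbelow_sub : ∀ {V W}, V ≤ W → below V ⊆ below W := fun {V W} h P hP => by
    rw [hbelow] at hP ⊢
    exact ⟨hP.1, hP.2.trans h⟩
  -- the inequality at every node of the tree, by induction on the number of leaves below it
  have key : ∀ n : ℕ, ∀ V ∈ J, (below V).card ≤ n →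
      ∑ P ∈ below V, ramificationIndex K P * inertiaDegree K P ≤
        ramificationIndex K V * inertiaDegree K V := by
    intro n
    induction n with
    | zero =>
      intro V _ hcard
      rw [Nat.le_zero, Finset.card_eq_zero] at hcard
      rw [hcard, Finset.sum_empty]
      exact Nat.zero_le _
    | succ n ih =>
      intro V hV hcard
      by_cases hVF : V ∈ F
      · -- a leaf: only `V` itself lies below `V`
        have hbel : below V = {V} := by
          ext P
          rw [hbelow, Finset.mem_singleton]
          constructor
          · rintro ⟨hP, hPV⟩
            exact hinc P hP V hVF hPV
          · rintro rfl
            exact ⟨hVF, le_rfl⟩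
        rw [hbel, Finset.sum_singleton]
      -- an internal node `V = P ⊔ Q`, `P ≠ Q`
      obtain ⟨P, hP, Q, hQ, hPQ⟩ := hJ.mp hV
      have hPV : P ≤ V := hPQ ▸ le_sup_left
      have hQV : Q ≤ V := hPQ ▸ le_sup_right
      -- the children: maximal elements of `J` strictly below `V`
      let Jb : Finset (ValuationSubring L) := J.filter (· < V)
      let C : Finset (ValuationSubring L) := Jb.filter fun c => ∀ c' ∈ Jb, c ≤ c' → c = c'
      have hCJb : ∀ c ∈ C, c ∈ Jb := fun c hc => (Finset.mem_filter.mp hc).1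
      have hClt : ∀ c ∈ C, c < V := fun c hc => (Finset.mem_filter.mp (hCJb c hc)).2
      have hCJ : ∀ c ∈ C, c ∈ J := fun c hc => (Finset.mem_filter.mp (hCJb c hc)).1
      have hCmax : ∀ c ∈ C, ∀ c' ∈ Jb, c ≤ c' → c = c' := fun c hc =>
        (Finset.mem_filter.mp hc).2
      have hm1 : ∀ U ∈ Jb, ∃ c ∈ C, U ≤ c := fun U hU => by
        obtain ⟨b, hUb, hb⟩ := Jb.exists_le_maximal hU
        exact ⟨b, Finset.mem_filter.mpr ⟨hb.1, fun c' hc' hbc' => le_antisymm hbc' (hb.2 hc' hbc')⟩,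
          hUb⟩
      have hm2 : ∀ P' ∈ below V, P' ∈ Jb := fun P' hP' => by
        obtain ⟨hP'F, hP'V⟩ := (hbelow V P').mp hP'
        refine Finset.mem_filter.mpr ⟨hFJ P' hP'F, lt_of_le_of_ne hP'V ?_⟩
        rintro rfl
        exact hVF hP'F
      have hCleaf : ∀ c ∈ C, ∃ R ∈ F, R ≤ c := fun c hc => by
        obtain ⟨R, hR, S, -, hRS⟩ := hJ.mp (hCJ c hc)
        exact ⟨R, hR, hRS ▸ le_sup_left⟩
      -- two children above a common valuation ring coincide
      have hCeq : ∀ c₁ ∈ C, ∀ c₂ ∈ C, ∀ R : ValuationSubring L, R ≤ c₁ → R ≤ c₂ → c₁ = c₂ :=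
        fun c₁ hc₁ c₂ hc₂ R h₁ h₂ => by
          rcases le_or_le_of_le_of_le h₁ h₂ with h | h
          · exact hCmax c₁ hc₁ c₂ (hCJb c₂ hc₂) h
          · exact (hCmax c₂ hc₂ c₁ (hCJb c₁ hc₁) h).symm
      -- the children pairwise generate `V`
      have hm3 : ∀ c₁ ∈ C, ∀ c₂ ∈ C, c₁ ≠ c₂ → c₁ ⊔ c₂ = V := fun c₁ hc₁ c₂ hc₂ hne => by
        obtain ⟨R₁, hR₁, hR₁c⟩ := hCleaf c₁ hc₁
        obtain ⟨R₂, hR₂, hR₂c⟩ := hCleaf c₂ hc₂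
        have hle : c₁ ⊔ c₂ ≤ V := sup_le (hClt c₁ hc₁).le (hClt c₂ hc₂).le
        by_contra hneV
        have hUJb : R₁ ⊔ R₂ ∈ Jb := Finset.mem_filter.mpr
          ⟨hJ.mpr ⟨R₁, hR₁, R₂, hR₂, rfl⟩,
            lt_of_le_of_lt (sup_le_sup hR₁c hR₂c) (lt_of_le_of_ne hle hneV)⟩
        obtain ⟨c, hc, hUc⟩ := hm1 _ hUJb
        have h1 : c = c₁ := hCeq c hc c₁ hc₁ R₁ (le_sup_left.trans hUc) hR₁c
        have h2 : c = c₂ := hCeq c hc c₂ hc₂ R₂ (le_sup_right.trans hUc) hR₂c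
        exact hne (h1.symm.trans h2)
      -- the child of a leaf below `V`
      have hchild : ∀ P' ∈ below V, ∃ c ∈ C, P' ≤ c := fun P' hP' => hm1 P' (hm2 P' hP')
      choose! child hchildC hchildle using hchild
      have hfib : ∀ c ∈ C, (below V).filter (fun P' => child P' = c) = below c := fun c hc => by
        ext P'
        rw [Finset.mem_filter, hbelow, hbelow]
        constructor
        · rintro ⟨hP', rfl⟩
          exact ⟨hP'.1, hchildle P' ((hbelow V P').mpr hP')⟩
        · rintro ⟨hP'F, hP'c⟩
          have hP'V : P' ∈ below V := (hbelow V P').mpr ⟨hP'F, hP'c.trans (hClt c hc).le⟩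
          exact ⟨⟨hP'F, hP'c.trans (hClt c hc).le⟩,
            hCeq _ (hchildC P' hP'V) c hc P' (hchildle P' hP'V) hP'c⟩
      -- strictly fewer leaves lie below a child
      have hm5 : ∀ c ∈ C, (below c).card ≤ n := fun c hc => by
        have hsub : below c ⊆ below V := hbelow_sub (hClt c hc).le
        have hne' : below c ≠ below V := fun heq => by
          have hPc : P ∈ below c := by rw [heq, hbelow]; exact ⟨hP, hPV⟩
          have hQc : Q ∈ below c := by rw [heq, hbelow]; exact ⟨hQ, hQV⟩
          have hVc : V ≤ c := hPQ ▸ sup_le ((hbelow c P).mp hPc).2 ((hbelow c Q).mp hQc).2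
          exact (hClt c hc).ne (le_antisymm (hClt c hc).le hVc)
        have hlt := Finset.card_lt_card (Finset.ssubset_iff_subset_ne.mpr ⟨hsub, hne'⟩)
        omega
      -- assemble: group the leaves by children, induct, and apply the relative inequality
      calc ∑ P' ∈ below V, ramificationIndex K P' * inertiaDegree K P'
          = ∑ c ∈ C, ∑ P' ∈ (below V).filter (fun P' => child P' = c),
              ramificationIndex K P' * inertiaDegree K P' :=
            (Finset.sum_fiberwise_of_maps_to (fun P' hP' => hchildC P' hP') _).symm
        _ = ∑ c ∈ C, ∑ P' ∈ below c, ramificationIndex K P' * inertiaDegree K P' :=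
            Finset.sum_congr rfl fun c hc => by rw [hfib c hc]
        _ ≤ ∑ c ∈ C, ramificationIndex K c * inertiaDegree K c :=
            Finset.sum_le_sum fun c hc => ih c (hCJ c hc) (hm5 c hc)
        _ = ∑ c : ↥C, ramificationIndex K (c : ValuationSubring L) * inertiaDegree K (c : ValuationSubring L) :=
            (Finset.sum_coe_sort C _).symm
        _ ≤ ramificationIndex K V * inertiaDegree K V :=
            sum_ramificationIndex_mul_inertiaDegree_le_of_sup_eq K V
              (fun c : ↥C => (c : ValuationSubring L)) (fun c => (hClt c c.2).le)
              (fun c => (hClt c c.2).ne)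
              (fun c₁ c₂ hne => hm3 c₁ c₁.2 c₂ c₂.2 fun h => hne (Subtype.ext h)) O
              (fun c => hJO c (hCJ c c.2))
  -- the top of the tree lies above all of `F`
  obtain ⟨P₀, hP₀⟩ := hFne
  obtain ⟨T, hT⟩ := J.exists_maximal ⟨P₀, hFJ P₀ hP₀⟩
  have hTJ : T ∈ J := hT.1
  have hbelT : below T = F := by
    ext P'
    rw [hbelow]
    refine ⟨fun h => h.1, fun hP' => ⟨hP', ?_⟩⟩
    obtain ⟨P, hP, Q, -, hPQ⟩ := hJ.mp hTJ
    have hU : P' ⊔ P ∈ J := hJ.mpr ⟨P', hP', P, hP, rfl⟩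
    have hPT : P ≤ T := hPQ ▸ le_sup_left
    rcases le_or_le_of_le_of_le (le_sup_right : P ≤ P' ⊔ P) hPT with h | h
    · exact le_sup_left.trans h
    · exact le_sup_left.trans (hT.2 hU h)
  have h := key F.card T hTJ (by rw [hbelT])
  rw [hbelT] at h
  exact h.trans (ramificationIndex_mul_inertiaDegree_le_finrank K T).2.2

end Tree

/-- **The fundamental inequality `n ≥ ∑ᵢ eᵢ fᵢ`** (Kuhlmann 2010, §1, (1), p. 3; [Z–S] II, Ch. VI
§11, Thm. 19; Bourbaki, *Alg. Comm.* VI §8 no. 3, Thm. 1): DISCHARGE of the named fact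
`FundamentalInequality` — for `L/K` finite and a valuation ring `O` of `K`, the valuation rings
of `L` lying over `O` are finitely many and `∑ e f ≤ [L : K]` over them. PROVED from
`sum_ramificationIndex_mul_inertiaDegree_le_finrank` (finiteness: `n + 1` distinct extensions
would give `n + 1 ≤ ∑ e f ≤ n`, as `e f ≥ 1`).
[cite: Kuhlmann2010, Section 1, (1) (p. 3 of arXiv:1003.5678)] -/
theorem FundamentalInequality_holds : FundamentalInequality.{u} := by
  intro K L _ _ _ hfin O
  classical
  haveI := hfin
  set E : Set (ValuationSubring L) := {O' | O'.comap (algebraMap K L) = O} with hE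
  have hfinE : E.Finite := by
    by_contra hinf
    obtain ⟨F, hFE, hcard⟩ := Set.Infinite.exists_subset_card_eq hinf (Module.finrank K L + 1)
    have h1 := sum_ramificationIndex_mul_inertiaDegree_le_finrank K O F fun P hP => hFE hP
    have h2 : F.card ≤ ∑ P ∈ F, ramificationIndex K P * inertiaDegree K P := by
      rw [Finset.card_eq_sum_ones]
      refine Finset.sum_le_sum fun P _ => ?_
      have h := one_le_ramificationIndex_and_inertiaDegree K P
      exact Nat.mul_le_mul h.1 h.2
    omega
  refine ⟨hfinE.toFinset, fun O' => by rw [Set.Finite.mem_toFinset, hE, Set.mem_setOf_eq], ?_⟩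
  exact sum_ramificationIndex_mul_inertiaDegree_le_finrank K O _ fun P hP => by
    rwa [Set.Finite.mem_toFinset, hE, Set.mem_setOf_eq] at hP

end Literature.AlgebraicGeometry.Resolution
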